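import Summits.ValiantsHypothesis.ValiantsHypothesis.Theorems.LangWeilTransferTameResolutionAssemblyPrelims

/-!
# LangWeilTransfer, support item `TameResolution` (stmt-ValiantsHypothesis-6378) — integer
# algebraic equations over a transcendence basis

Route `LangWeilTransfer` of `ValiantsHypothesis` (conditional route; honest framing: bookkeeping,
nothing here bears on VP ≠ VNP). Quantitative pass, step (C) of the roadmap note of val-lit-p6 g9:
in each round of the Noether loop the machinery `eliminant_identity_coord` / `exists_relation_coord`
needs the qualitative hypothesis `halg` — every coordinate has SOME non-zero equation over `ℤ[T̄]`
— for the current transcendence basis `T̄` (the coordinates are not yet integral there). This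
file provides it: if `T̄` is a transcendence basis of `F₀ / ℚ`, every `x ∈ F₀` satisfies
`P(T̄, x) = 0` for some non-zero `P ∈ ℤ[T][U]`.

* `exists_rat_relation_of_isTranscendenceBasis`, `exists_int_relation_of_isTranscendenceBasis`.
-/

noncomputable section

open MvPolynomial

-- the summit and the problem share the name `ValiantsHypothesis` (D-0017 single-conjunct layout)
set_option linter.dupNamespace false

namespace Summit.ValiantsHypothesis.ValiantsHypothesis.Theorems.LangWeilTransfer

variable {F₀ : Type*} [Field F₀] [CharZero F₀] {r : ℕ}

/-- Over a transcendence basis `T̄` of `F₀ / ℚ`, every element has a non-zero equation with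
coefficients in `ℚ[T]` (evaluated through `aeval T̄`). -/
theorem exists_rat_relation_of_isTranscendenceBasis (T : Fin r → F₀) (hT : IsTranscendenceBasis ℚ T)
    (x : F₀) :
    ∃ p : Polynomial (MvPolynomial (Fin r) ℚ), p ≠ 0 ∧
      (p.map (aeval T : MvPolynomial (Fin r) ℚ →ₐ[ℚ] F₀).toRingHom).eval x = 0 := by
  set R₁ : Subalgebra ℚ F₀ := Algebra.adjoin ℚ (Set.range T) with hR₁
  haveI : Algebra.IsAlgebraic R₁ F₀ := hT.isAlgebraic
  obtain ⟨p, hp0, hp⟩ := (Algebra.IsAlgebraic.isAlgebraic (R := R₁) x)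
  -- lift the coefficients from `ℚ[T̄]` to `ℚ[T]`
  let ρ : MvPolynomial (Fin r) ℚ →+* R₁ :=
    ((aeval T : MvPolynomial (Fin r) ℚ →ₐ[ℚ] F₀).codRestrict R₁ fun q => by
      rw [hR₁, ← MvPolynomial.aeval_range]; exact ⟨q, rfl⟩).toRingHom
  have hρsurj : Function.Surjective ρ := by
    rintro ⟨z, hz⟩
    rw [hR₁, ← MvPolynomial.aeval_range] at hz
    obtain ⟨q, rfl⟩ := hz
    exact ⟨q, rfl⟩
  have hlift : p ∈ Polynomial.lifts ρ := by
    rw [Polynomial.lifts_iff_coeff_lifts]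
    intro k; exact hρsurj _
  obtain ⟨q, hqp⟩ := (Polynomial.mem_lifts p).1 hlift
  refine ⟨q, ?_, ?_⟩
  · rintro rfl
    rw [Polynomial.map_zero] at hqp
    exact hp0 hqp.symm
  · have hcomp : (aeval T : MvPolynomial (Fin r) ℚ →ₐ[ℚ] F₀).toRingHom = (algebraMap R₁ F₀).comp ρ := by
      ext z <;> rfl
    rw [hcomp, ← Polynomial.map_map, hqp, Polynomial.eval_map]
    exact hp

/-- **Integer equations over a transcendence basis.** With coefficients in `ℤ[T]`, evaluated
through `aeval T̄ ∘ (ℤ → ℚ)`. -/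
theorem exists_int_relation_of_isTranscendenceBasis (T : Fin r → F₀) (hT : IsTranscendenceBasis ℚ T)
    (x : F₀) :
    ∃ P : Polynomial (MvPolynomial (Fin r) ℤ), P ≠ 0 ∧
      (P.map ((aeval T : MvPolynomial (Fin r) ℚ →ₐ[ℚ] F₀).toRingHom.comp
        (MvPolynomial.map (Int.castRingHom ℚ)))).eval x = 0 := by
  obtain ⟨p, hp0, hp⟩ := exists_rat_relation_of_isTranscendenceBasis T hT x
  exact exists_int_relation_of_rat _ x p hp0 hp

end Summit.ValiantsHypothesis.ValiantsHypothesis.Theorems.LangWeilTransfer
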